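import Summits.Ventures.CertifiedManyBodySolver.Theorems.CovHg1201M19bKinematicPartsTp
import Summits.Ventures.CertifiedManyBodySolver.Downfold.BoxesHg1201ESlantCutSlots
import HarnessLib

/-!
# Theorems/CovHg1201M19bSlantParts.lean — route «CovHg1201M19b» (hubbard-cov-hg1201-1): after «SLANT-CUT» the certificate part of BOTH cruxes is the
# upper-left TRIANGLE `{σ ∈ [−27/50, −53/100], n ∈ [179/200, 183/200], n ≥ 179/200 + 2(σ + 27/50)}` — HALF of the outer strip

Supports stmt-Ventures-26187 «PatchBottom» (and stmt-Ventures-26186 «PatchLeftEdge»). Ingredients: hubbard-cov-hg1201-box-2 g1's outer-strip reductions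
(`Theorems/CovHg1201M19bKinematicPartsTp.lean`, p628941: item ⇐ item on `σ ∈ [−27/50, −53/100] × n ∈ [179/200, 183/200]`) and this seat's state-free words UNDER THE
CHORD between the N-KINCUT corner `(−27/50, 179/200)` and the TP-KINCUT corner `(−53/100, 183/200)` (`Downfold/BoxesHg1201ESlantCutSlots.lean`:
`hg1201M19b_patchBottom_slantSlots_kinematic`, `hg1201M19b_patchLeftEdge_slantSlots_kinematic`; generic chord transport `Observables/StiffnessHalfBathtubSlant.lean`, p629801 —
the two `M = 512` rows of record joined by joint convexity, zero new kernel row).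
* `covHg1201M19b_PatchBottom_of_outerTriangle` / `covHg1201M19b_PatchLeftEdge_of_outerTriangle`: (item restricted to the TRIANGLE) → item.
* `covHg1201M19b_cruxes_of_outerTriangles`: both at once.
HONEST FRAMING: set algebra + one-body kinematics + the torus-limit variational inequality; zero solve, no claim node, no definition; CONDITIONAL on the triangle, where the
K1/K2 certificates (pinned pairs / WN reads, captain hubbard-cov-hg1201-plan-1) are still owed; certified stiffness-scale CEILINGS on a downfolded screening-grade box =
CONTROL / CALIBRATION + labelled heuristic (xx1; content = below `0.98 ×` the kinematic MAJORANT, no suppression below free claimed); a ceiling never speaks to the presence of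
superconductivity; not a `T_c`, phase or pressure sentence; NO item, stub or rung leaf is closed by this file; no summit statement is proved. Seat hubbard-cov-hg1201-unc-2 g3
(`prover-hubbard-cov-hg1201-unc-2-g2-0`), cell `pub/hubbard-downfold`.
-/

noncomputable section

namespace Summit.Ventures.CertifiedManyBodySolver.Theorems

open Set Filter Topology
open Summit.Ventures.CertifiedManyBodySolver.Theses.CovHg1201M19b
open Summit.Ventures.CertifiedManyBodySolver.Observables
open Summit.Ventures.CertifiedManyBodySolver.Downfold
open Summit.Ventures.CertifiedManyBodySolver
open Literature.MathematicalPhysics.QuantumLattice Literature.MathematicalPhysics.QuantumLattice.ThermodynamicLimit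
open Literature.Probability.LatticeModels
open Matrix HubbardWave0
open scoped BigOperators ComplexOrder

/-- **«PatchBottom» (stmt-Ventures-26187) from its OUTER TRIANGLE**: the item restricted to slots `σ ∈ [−27/50, −53/100]` (sources `s ∈ [−27/50, σ]`) and densities
`n ∈ [179/200, 183/200]` with `n ≥ 179/200 + 2(σ + 27/50)` implies the item — densities `≤ 179/200` (box-2 g0), slots `≥ −53/100` (TP-KINCUT) and the trapezoid under the
chord (SLANT-CUT) are state-free. CONDITIONAL on the triangle. [cite: ScalapinoWhiteZhang1993, §II] [cite: LiebLoss1993, §8, Theorem 8.2] -/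
theorem covHg1201M19b_PatchBottom_of_outerTriangle
    (h : ∀ n ∈ Set.Icc (179 / 200 : ℝ) (183 / 200), ∀ σ ∈ Set.Icc (-27 / 50 : ℝ) (-53 / 100), 179 / 200 + 2 * (σ + 27 / 50) ≤ n →
      ∀ s ∈ Set.Icc (-27 / 50 : ℝ) σ,
      ∀ (ω : InfVolFermionState 2) (Ls : ℕ → ℕ) (ψ : ∀ L, Fock (Orb (FermionTorus 2 L))),
      Tendsto Ls atTop atTop →
      (∀ j, IsGroundStateInSector (hubbardTorusTT' (Ls j) 1 s (7 / 2)) (rectN n (Ls j)) 0 (ψ (Ls j))) →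
      (∀ j, star (ψ (Ls j)) ⬝ᵥ ψ (Ls j) = 1) → ω.IsTorusLimitOf ψ Ls →
      -(5166800 / 10000000 : ℝ) ≤ ((Finset.univ : Finset (DihedralGroup 4)).card : ℝ)⁻¹ * ∑ g ∈ (Finset.univ : Finset (DihedralGroup 4)),
        (ω.expect (d4ShiftSet g 0 (Literature.Probability.LatticeModels.box 2 7))
          (fermionEmbed (PolySite.d4Emb g 0 (Literature.Probability.LatticeModels.box 2 7)) (-oddMomentObsTT σ (7 / 2) 0))).re) :
    PatchBottom := by
  refine covHg1201M19b_PatchBottom_of_outerStrip (fun n hn σ hσ s hs ω Ls ψ hLs hψ h1 hω => ?_)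
  rcases le_or_gt n (179 / 200 + 2 * (σ + 27 / 50)) with hle | hgt
  · exact hg1201M19b_patchBottom_slantSlots_kinematic n ⟨le_trans (by norm_num) hn.1, hn.2⟩ σ hσ hle s hs ω Ls ψ hLs hψ h1 hω
  · exact h n hn σ hσ hgt.le s hs ω Ls ψ hLs hψ h1 hω

/-- **«PatchLeftEdge» (stmt-Ventures-26186) from its OUTER TRIANGLE**: the item restricted to `σ ∈ [−27/50, −53/100]`, `n ∈ [179/200, 183/200]`,
`n ≥ 179/200 + 2(σ + 27/50)` (states at `(−27/50, U′, n)`, `U′ ∈ [7/2, 44/5]`) implies the item. CONDITIONAL on the triangle.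
[cite: ScalapinoWhiteZhang1993, §II] [cite: LiebLoss1993, §8, Theorem 8.2] -/
theorem covHg1201M19b_PatchLeftEdge_of_outerTriangle
    (h : ∀ n ∈ Set.Icc (179 / 200 : ℝ) (183 / 200), ∀ σ ∈ Set.Icc (-27 / 50 : ℝ) (-53 / 100), 179 / 200 + 2 * (σ + 27 / 50) ≤ n →
      ∀ U' ∈ Set.Icc (7 / 2 : ℝ) (44 / 5),
      ∀ (ω : InfVolFermionState 2) (Ls : ℕ → ℕ) (ψ : ∀ L, Fock (Orb (FermionTorus 2 L))),
      Tendsto Ls atTop atTop →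
      (∀ j, IsGroundStateInSector (hubbardTorusTT' (Ls j) 1 (-27 / 50) U') (rectN n (Ls j)) 0 (ψ (Ls j))) →
      (∀ j, star (ψ (Ls j)) ⬝ᵥ ψ (Ls j) = 1) → ω.IsTorusLimitOf ψ Ls →
      -(5166800 / 10000000 : ℝ) ≤ ((Finset.univ : Finset (DihedralGroup 4)).card : ℝ)⁻¹ * ∑ g ∈ (Finset.univ : Finset (DihedralGroup 4)),
        (ω.expect (d4ShiftSet g 0 (Literature.Probability.LatticeModels.box 2 7))
          (fermionEmbed (PolySite.d4Emb g 0 (Literature.Probability.LatticeModels.box 2 7)) (-oddMomentObsTT σ U' 0))).re) :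
    PatchLeftEdge := by
  refine covHg1201M19b_PatchLeftEdge_of_outerStrip (fun n hn σ hσ U' hU' ω Ls ψ hLs hψ h1 hω => ?_)
  rcases le_or_gt n (179 / 200 + 2 * (σ + 27 / 50)) with hle | hgt
  · exact hg1201M19b_patchLeftEdge_slantSlots_kinematic n ⟨le_trans (by norm_num) hn.1, hn.2⟩ σ hσ hle U' hU' ω Ls ψ hLs hψ h1 hω
  · exact h n hn σ hσ hgt.le U' hU' ω Ls ψ hLs hψ h1 hω

/-- **Both cruxes of «CovHg1201M19b» from their OUTER TRIANGLES at once** (the bundle pair the K1/K2 programme still owes, now on `1/88` of the box each).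
[cite: ScalapinoWhiteZhang1993, §II] -/
theorem covHg1201M19b_cruxes_of_outerTriangles
    (hB : ∀ n ∈ Set.Icc (179 / 200 : ℝ) (183 / 200), ∀ σ ∈ Set.Icc (-27 / 50 : ℝ) (-53 / 100), 179 / 200 + 2 * (σ + 27 / 50) ≤ n →
      ∀ s ∈ Set.Icc (-27 / 50 : ℝ) σ,
      ∀ (ω : InfVolFermionState 2) (Ls : ℕ → ℕ) (ψ : ∀ L, Fock (Orb (FermionTorus 2 L))),
      Tendsto Ls atTop atTop →
      (∀ j, IsGroundStateInSector (hubbardTorusTT' (Ls j) 1 s (7 / 2)) (rectN n (Ls j)) 0 (ψ (Ls j))) →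
      (∀ j, star (ψ (Ls j)) ⬝ᵥ ψ (Ls j) = 1) → ω.IsTorusLimitOf ψ Ls →
      -(5166800 / 10000000 : ℝ) ≤ ((Finset.univ : Finset (DihedralGroup 4)).card : ℝ)⁻¹ * ∑ g ∈ (Finset.univ : Finset (DihedralGroup 4)),
        (ω.expect (d4ShiftSet g 0 (Literature.Probability.LatticeModels.box 2 7))
          (fermionEmbed (PolySite.d4Emb g 0 (Literature.Probability.LatticeModels.box 2 7)) (-oddMomentObsTT σ (7 / 2) 0))).re)
    (hL : ∀ n ∈ Set.Icc (179 / 200 : ℝ) (183 / 200), ∀ σ ∈ Set.Icc (-27 / 50 : ℝ) (-53 / 100), 179 / 200 + 2 * (σ + 27 / 50) ≤ n →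
      ∀ U' ∈ Set.Icc (7 / 2 : ℝ) (44 / 5),
      ∀ (ω : InfVolFermionState 2) (Ls : ℕ → ℕ) (ψ : ∀ L, Fock (Orb (FermionTorus 2 L))),
      Tendsto Ls atTop atTop →
      (∀ j, IsGroundStateInSector (hubbardTorusTT' (Ls j) 1 (-27 / 50) U') (rectN n (Ls j)) 0 (ψ (Ls j))) →
      (∀ j, star (ψ (Ls j)) ⬝ᵥ ψ (Ls j) = 1) → ω.IsTorusLimitOf ψ Ls →
      -(5166800 / 10000000 : ℝ) ≤ ((Finset.univ : Finset (DihedralGroup 4)).card : ℝ)⁻¹ * ∑ g ∈ (Finset.univ : Finset (DihedralGroup 4)),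
        (ω.expect (d4ShiftSet g 0 (Literature.Probability.LatticeModels.box 2 7))
          (fermionEmbed (PolySite.d4Emb g 0 (Literature.Probability.LatticeModels.box 2 7)) (-oddMomentObsTT σ U' 0))).re) :
    PatchBottom ∧ PatchLeftEdge :=
  ⟨covHg1201M19b_PatchBottom_of_outerTriangle hB, covHg1201M19b_PatchLeftEdge_of_outerTriangle hL⟩

end Summit.Ventures.CertifiedManyBodySolver.Theorems

end
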